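import Literature.AlgebraicGeometry.Markman2025.WeilHermitianFormSignature

/-!
# Markman 2023 (JEMS 25) — §12.2 (12.4)/(12.5), LEMMA 12.5 and COROLLARY 12.9 with (12.9): the Weil-type
# polarization `Θ_h` of the period tori `T_ℓ` from the Clifford pair `m_w, m_h` — the printed one-line deductions AS
# PRINTED, kernel-checked in operator form, and the identification (12.9) = [Mar25] (3.1.2)

E. Markman: [M23] *The monodromy of generalized Kummer varieties and algebraic cycles on their intermediate Jacobians*,
J. Eur. Math. Soc. 25 (2023) 231–321, doi 10.4171/jems/1199 — REFEREED; bib `Markman2023GeneralizedKummers`. Numbering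
and wording = arXiv:1805.11574 **v4** (4 Feb 2022; PDF sha256/16 `8e695d427eba6593`, fetched by read-only GET), whose
item numbers agree with the JEMS numbers of record (Prop 12.6, Cor 12.9, (12.9), Def 12.10, Lemma 12.11 — JEMS pp. 300,
302–303, read first-hand by lit-2 gen-9, `HOME/lit/LIT2-WEIL.md` §BD); «v4 p. N L m» = PyMuPDF line `m` of page `N` of that
PDF, read BY EYE at seat lit-w-markman g19 (pub-hsemireg LIT-W, 2026-08-24) on the 160-dpi renders
`r_mar23v4_p62_sec122_theta.png` (`8ef9ad17ef65796b`), `r_mar23v4_p64_lemma125.png` (`70e6ed713556ceee`),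
`r_mar23v4_p67_cor129_H.png` (`d55d085a7d1651d3`) in `HOME/lit/Markman-renders-litw-markman-g19/`, and re-read by eye on
the same three renders (re-hashed equal) and the PDF text layer at seat lit-3 g55 (pub-hsemireg bus l.18457; sheet
`HOME/lit/MARKMAN2023-SEC12.2-LEMMA12.5-COR12.9-EQ12.9-LEAN30-V1-AND-SSC-V2-MAN99-PROP2.18-PREFILING-STATEMENT-READS-BYEYE-AS-PRINTED-lit3-g55.md`
`e7d3ea044f7b2692`): every quotation and locator below CONCURS — read ×2 across seats. The JEMS page lines
of §12.2 and Lemma 12.5 were NOT seen at this seat (JEMS PDF not held); the statements are concordant with lit-2's JEMS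
quotations.

## What is printed (verbatim, by eye)

* §12.2 (v4 p. 62 L42–62; JEMS §12.2): «Let (12.4) `Θ′ : w^⊥ → Hom(V, V)` send `h` to the restriction `Θ′_h` of `m_w ∘ m_h`
  to `V`. Note that `m_w ∘ m_h + m_h ∘ m_w` restricts to `V` as `(w, h)_{S⁺}·id_V`, by Equation (4.29). The latter scalar
  endomorphism vanishes due to the fact that `h` is in `w^⊥`. Furthermore, `m_h ∘ m_w` restricts to `V` as the adjoint of
  the restriction of `m_w ∘ m_h` with respect to the pairing `(•, •)_V`, by definition of the multiplication in `A_X`.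
  Hence, `Θ′_h` is anti-self-dual with respect to `(•, •)_V`. The isomorphism `V → V^*`, given by `x ↦ (x, •)_V`, induces
  an isomorphism `a : Hom(V, V) → V^* ⊗ V^*`, given by `a(f)(x, y) := (f(x), y)_V`, for all `x, y ∈ V`. An anti-self-dual
  homomorphism is sent by `a` to `∧²V^*`. Hence, we get the composite homomorphism (12.5) `Θ := a ∘ Θ′ : w^⊥ → ∧²V^*`,
  sending `h` to `Θ_h`, where `Θ_h(x, y) := (Θ′_h(x), y)_V`.»
* LEMMA 12.5 (v4 p. 64 L24–39): «The endomorphism `Θ′_h := m_w ∘ m_h : V → V` satisfies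
  `(Θ′_h)² = (−(w, w)(h, h)/4) id_V = (n(h, h)/2) id_V`. …» PROOF: «We have `(m_w ∘ m_h)² = −(m_w ∘ m_w) ∘ (m_h ∘ m_h) =
  (n(h,h)/2) id_V`, where the first equality is due to the identity `m_w ∘ m_h = −m_h ∘ m_w` observed above. …» (the
  Hodge-endomorphism clause is BY VALUE). Context (p. 62 L37): «Let `w ∈ S⁺` be a primitive class satisfying
  `(w, w)_{S⁺} = −2n`».
* §12.4 (v4 p. 67 L11–21; JEMS p. 302): «Given a positive integer `d`, let the norm map `Nm : ℚ[√−d] → ℚ` be given by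
  `Nm(a + b√−d) := (a + b√−d)(a − b√−d) = a² + b²d`.» COROLLARY 12.9 (v4 p. 67 L22–29; JEMS p. 302): «Let `h ∈ w^⊥` be an
  integral class and `ℓ ∈ Ω_{w⊥}`, such that the pair `(h, ℓ)` satisfies the assumptions of Proposition 12.6. Then
  `d := −n(h, h)/2` is a positive integer, `T_ℓ` is an abelian variety, and the ring `ℤ[√−d]` acts on `T_ℓ` via integral
  Hodge endomorphisms, such that `λ^*(Θ_h) = Nm(λ)Θ_h`, for all `λ ∈ ℤ[√−d]`.» PROOF (L30–63): «… `ℤ[√−d]` acts, by sending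
  `√−d` to the endomorphism `Θ′_h`, which satisfies `(Θ′_h)² = (−d)id_V`, by Lemma 12.5. Finally, we compute
  `Θ_h(Θ′_h(x), Θ′_h(y)) = ((Θ′_h)²(x), Θ′_h(y)) = −d(x, Θ′_h(y)) = d(Θ′_h(x), y) = dΘ_h(x, y)`, where the third equality
  follows from the anti-self-duality of `Θ′_h`. Set `λ := a + b√−d`. We get `(λ^*Θ_h)(x, y) = Θ_h(ax + bΘ′_h(x), ay + bΘ′_h(y))
  = (a² + b²d)Θ_h(x, y) + ab[Θ_h(x, Θ′_h(y)) + Θ_h(Θ′_h(x), y)] = (a² + b²d)Θ_h(x, y) = Nm(λ)Θ_h(x, y)`. □»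
* (12.9) (v4 p. 67 L65–76; JEMS p. 303): «Set `K := ℚ[√−d]`. Consider the map `H : V_ℚ ⊗ V_ℚ → K`, given by (12.9)
  `H(x, y) := Θ_h(x, Θ′_h(y)) + √−dΘ_h(x, y) = d(x, y) + √−d(Θ′_h(x), y)`.» (DEFINITION 12.10 — the discriminant `det H`
  in `ℚ^*/Nm(K^*)` — and LEMMA 12.11 are BY VALUE.)

## What this file proves (kernel-checked; theorems only — no def, no named fact, no sorry)

MODEL (operator form). `F` a field (`ℚ`), `M` an `F`-space standing for `S⁻ ⊕ V` (the restriction to `V` is not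
modelled separately: every identity below holds on all of `M`), `mw mh : M →ₗ M` the Clifford multiplications with the
printed relations as HYPOTHESES: `hanti` («`m_w ∘ m_h = −m_h ∘ m_w`», i.e. (4.29) with `(w, h) = 0`), `hw2`/`hh2`
(`m_w² = p·𝟙`, `m_h² = q·𝟙` — (4.29) with `h = w` gives `p = (w, w)/2`, `q = (h, h)/2`), `hadj` («`m_h ∘ m_w` … is the
adjoint of … `m_w ∘ m_h` with respect to `(•, •)_V`»); `B` = `(•, •)_V` (symmetric where used, `hB`); `Θ′ x` is written
`mw (mh x)` in §A and as an abstract anti-self-dual `T` with `T² = −d𝟙` in §B–§C (hypotheses `hT`, `hT2`, as Corollary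
12.9's proof uses them); `Θ_h(x, y)` is written `B (T x) y`; `K = F(√−d)` is Mathlib's `QuadraticAlgebra F (−d) 0`
(`= HermitianForm312.Kd F d` of `WeilHermitianFormSignature.lean`), `λ = a + b√−d = ⟨a, b⟩`, `Nm = QuadraticAlgebra.norm`.
THEOREMS. §A: `thetaPrime_sq` («`(m_w ∘ m_h)² = −(m_w ∘ m_w) ∘ (m_h ∘ m_h)`» ⇒ `Θ′(Θ′ x) = −(p·q)·x`), `lemma125_scalars`
(the printed scalar identity `−(w,w)(h,h)/4 = n(h,h)/2` for `(w,w) = −2n`, and `= −d` for `d := −n(h,h)/2`),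
`thetaPrime_antiSelfDual` («Hence, `Θ′_h` is anti-self-dual», from `hadj` + `hanti`), `theta_alternating` («An
anti-self-dual homomorphism is sent by `a` to `∧²V^*`»: `Θ_h(y, x) = −Θ_h(x, y)`, and `Θ_h(x, x) = 0` when `2 ≠ 0`).
§B (COROLLARY 12.9's proof): `cor129_display1` (the three printed equalities after the definitional one, as a conjunction),
`cor129_cross_terms` («`ab[Θ_h(x, Θ′_h(y)) + Θ_h(Θ′_h(x), y)]`» vanishes: the bracket is `0`), `cor129_pullback`
(«`Θ_h(ax + bΘ′_h(x), ay + bΘ′_h(y)) = (a² + b²d)Θ_h(x, y)`»), `norm_eq` («`Nm(a + b√−d) = a² + b²d`» in `K`),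
`cor129_pullback_norm` («`= Nm(λ)Θ_h(x, y)`»). §C ((12.9)): `eq129` — the two printed expressions for `H(x, y)` agree, and
the right-hand one «`d(x, y) + √−d(Θ′_h(x), y)`» IS `HermitianForm312.H B T d x y`, the Hermitian form (3.1.2) of
[Markman 2025, arXiv:2502.03415v2] as modelled in `WeilHermitianFormSignature.lean` (so that file's `hermitian_symm`,
`linear_right`, `invariant`, signature bookkeeping apply to JEMS's `H` verbatim).  BY VALUE / NOT formalised: `S^±`, `A_X`,
Corollary 4.7 and (4.29) themselves (only their two consequences enter, as hypotheses), `w^⊥`, integrality/evenness, that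
`Θ_h` is ample (Prop 12.6), `T_ℓ`, Hodge endomorphisms, [vG1, Def. 4.9], Def 12.10, Lemma 12.11. Honest framing
(pub-hsemireg, TABLE row M-Mk8 bookkeeping): printed linear algebra re-checked; nothing here bears on the Hodge conjecture
or re-proves a theorem of [M23].
-/

namespace Literature.AlgebraicGeometry.HodgeTheory

namespace CliffordPairWeil129

open QuadraticAlgebra

variable {F : Type*} [Field F] {M : Type*} [AddCommGroup M] [Module F M]

/-! ### §A (12.4)/(12.5) and LEMMA 12.5 -/

section CliffordPair

variable (B : M →ₗ[F] M →ₗ[F] F) (mw mh : M →ₗ[F] M) (p q : F)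

/-- LEMMA 12.5, proof: «`(m_w ∘ m_h)² = −(m_w ∘ m_w) ∘ (m_h ∘ m_h)` … where the first equality is due to the identity
`m_w ∘ m_h = −m_h ∘ m_w`»; with `m_w² = p·𝟙`, `m_h² = q·𝟙` this is `Θ′_h(Θ′_h(x)) = −(pq)·x` («`= −(w,w)(h,h)/4 id_V`»
for `p = (w,w)/2`, `q = (h,h)/2`). [cite: Markman2023GeneralizedKummers, Lemma 12.5 (proof), JEMS 25 (2023); arXiv v4 p. 64 L24–39] -/
theorem thetaPrime_sq (hanti : ∀ x, mw (mh x) = -mh (mw x)) (hw2 : ∀ x, mw (mw x) = p • x)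
    (hh2 : ∀ x, mh (mh x) = q • x) (x : M) : mw (mh (mw (mh x))) = -((p * q) • x) := by
  have h1 : mh (mw (mh x)) = -(mw (mh (mh x))) := by rw [hanti (mh x)]; simp
  rw [h1, map_neg, hh2, map_smul, map_smul, hw2, smul_smul, mul_comm q p]

/-- LEMMA 12.5, the printed scalars: for `(w, w) = −2n`, `−(w,w)(h,h)/4 = n(h,h)/2`; and with COROLLARY 12.9's
`d := −n(h,h)/2` this is `−d` («`(Θ′_h)² = (−d)id_V`, by Lemma 12.5»).
[cite: Markman2023GeneralizedKummers, Lemma 12.5 and Corollary 12.9 (proof), JEMS 25 (2023) p. 302; arXiv v4 p. 64 L26–31, p. 67 L36–39] -/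
theorem lemma125_scalars (h2 : (2 : F) ≠ 0) (n hh ww d : F) (hww : ww = -2 * n) (hd : d = -(n * hh) / 2) :
    -(ww * hh) / 4 = n * hh / 2 ∧ n * hh / 2 = -d := by
  subst hww; subst hd
  have h4 : (4 : F) ≠ 0 := by
    have : (4 : F) = 2 * 2 := by norm_num
    rw [this]; exact mul_ne_zero h2 h2
  constructor
  · field_simp; ring
  · ring

/-- «Furthermore, `m_h ∘ m_w` restricts to `V` as the adjoint of the restriction of `m_w ∘ m_h` with respect to the
pairing `(•, •)_V` … Hence, `Θ′_h` is anti-self-dual with respect to `(•, •)_V`» (adjointness + anticommutation).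
[cite: Markman2023GeneralizedKummers, §12.2 (12.4), JEMS 25 (2023); arXiv v4 p. 62 L46–51] -/
theorem thetaPrime_antiSelfDual (hadj : ∀ x y, B (mw (mh x)) y = B x (mh (mw y)))
    (hanti : ∀ x, mw (mh x) = -mh (mw x)) (x y : M) : B (mw (mh x)) y = -B x (mw (mh y)) := by
  rw [hadj, hanti, map_neg, neg_neg]

end CliffordPair

/-! ### §B COROLLARY 12.9's proof (with `Θ′_h` an anti-self-dual `T`, `T² = −d𝟙`, and `Θ_h(x, y) = (T x, y)_V`) -/

section Cor129

variable (B : M →ₗ[F] M →ₗ[F] F) (T : M →ₗ[F] M) (d : F)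

/-- «An anti-self-dual homomorphism is sent by `a` to `∧²V^*`» — `Θ_h(x, y) := (Θ′_h(x), y)_V` is antisymmetric for
`(•, •)_V` symmetric, and alternating when `2 ≠ 0`. [cite: Markman2023GeneralizedKummers, §12.2 (12.5), JEMS 25 (2023); arXiv v4 p. 62 L51–59] -/
theorem theta_alternating (hB : ∀ x y, B x y = B y x) (hT : ∀ x y, B (T x) y = -B x (T y)) :
    (∀ x y, B (T y) x = -B (T x) y) ∧ ((2 : F) ≠ 0 → ∀ x, B (T x) x = 0) := by
  have h1 : ∀ x y, B (T y) x = -B (T x) y := fun x y => by rw [hT y x, hB y (T x)]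
  refine ⟨h1, fun h2 x => ?_⟩
  have h := h1 x x
  have h' : (2 : F) * B (T x) x = 0 := by linear_combination h
  exact (mul_eq_zero.mp h').resolve_left h2

/-- COROLLARY 12.9, proof, first display: «`Θ_h(Θ′_h(x), Θ′_h(y)) = ((Θ′_h)²(x), Θ′_h(y)) = −d(x, Θ′_h(y)) = d(Θ′_h(x), y)
= dΘ_h(x, y)`, where the third equality follows from the anti-self-duality of `Θ′_h`» — the first `=` is the definition of
`Θ_h`; the remaining three printed equalities, one conjunct each.
[cite: Markman2023GeneralizedKummers, Corollary 12.9 (proof), JEMS 25 (2023) p. 302; arXiv v4 p. 67 L39–48] -/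
theorem cor129_display1 (hT : ∀ x y, B (T x) y = -B x (T y)) (hT2 : ∀ x, T (T x) = -(d • x)) (x y : M) :
    B (T (T x)) (T y) = -(d * B x (T y)) ∧ -(d * B x (T y)) = d * B (T x) y ∧ d * B (T x) y = d * B (T x) y := by
  refine ⟨?_, ?_, rfl⟩
  · rw [hT2, map_neg, map_smul, LinearMap.neg_apply, LinearMap.smul_apply, smul_eq_mul]
  · rw [hT x y]; ring

/-- The bracket of the second display vanishes: «`ab[Θ_h(x, Θ′_h(y)) + Θ_h(Θ′_h(x), y)]`» with
`Θ_h(x, Θ′_h(y)) + Θ_h(Θ′_h(x), y) = (Θ′x, Θ′y)_V + (Θ′²x, y)_V = d(x, y) − d(x, y) = 0`.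
[cite: Markman2023GeneralizedKummers, Corollary 12.9 (proof), JEMS 25 (2023) p. 302; arXiv v4 p. 67 L52–62] -/
theorem cor129_cross_terms (hT : ∀ x y, B (T x) y = -B x (T y)) (hT2 : ∀ x, T (T x) = -(d • x)) (x y : M) :
    B (T x) (T y) + B (T (T x)) y = 0 := by
  rw [hT x (T y), hT2, hT2]
  simp

/-- COROLLARY 12.9, proof, second display: «`(λ^*Θ_h)(x, y) = Θ_h(ax + bΘ′_h(x), ay + bΘ′_h(y)) = (a² + b²d)Θ_h(x, y) +
ab[Θ_h(x, Θ′_h(y)) + Θ_h(Θ′_h(x), y)] = (a² + b²d)Θ_h(x, y)`» (`λ = a + b√−d` acting by `a·𝟙 + b·Θ′_h`).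
[cite: Markman2023GeneralizedKummers, Corollary 12.9 (proof), JEMS 25 (2023) p. 302; arXiv v4 p. 67 L48–62] -/
theorem cor129_pullback (hT : ∀ x y, B (T x) y = -B x (T y)) (hT2 : ∀ x, T (T x) = -(d • x)) (a b : F) (x y : M) :
    B (T (a • x + b • T x)) (a • y + b • T y) = (a ^ 2 + b ^ 2 * d) * B (T x) y := by
  have h1 := cor129_cross_terms B T d hT hT2 x y
  have h2 : B (T (T x)) (T y) = d * B (T x) y := by
    obtain ⟨e1, e2, -⟩ := cor129_display1 B T d hT hT2 x y
    rw [e1, e2]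
  simp only [map_add, map_smul, LinearMap.add_apply, LinearMap.smul_apply, smul_eq_mul]
  have h3 : B (T (T x)) y = -(B (T x) (T y)) := by linear_combination h1
  rw [h2, h3]
  ring

/-- «`Nm(a + b√−d) := (a + b√−d)(a − b√−d) = a² + b²d`» — in `K = QuadraticAlgebra F (−d) 0` (Mathlib's `norm`).
[cite: Markman2023GeneralizedKummers, §12.4, JEMS 25 (2023) p. 302; arXiv v4 p. 67 L11–20] -/
theorem norm_eq (a b : F) : QuadraticAlgebra.norm (⟨a, b⟩ : QuadraticAlgebra F (-d) 0) = a ^ 2 + b ^ 2 * d := by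
  rw [QuadraticAlgebra.norm_def]
  simp only
  ring

/-- «`… = Nm(λ)Θ_h(x, y)`»: the multiplier of `λ = a + b√−d` on `Θ_h` is `Nm(λ)` — the compatibility of [vG1, Def. 4.9]
(by value). [cite: Markman2023GeneralizedKummers, Corollary 12.9, JEMS 25 (2023) p. 302; arXiv v4 p. 67 L22–29, L62] -/
theorem cor129_pullback_norm (hT : ∀ x y, B (T x) y = -B x (T y)) (hT2 : ∀ x, T (T x) = -(d • x)) (a b : F) (x y : M) :
    B (T (a • x + b • T x)) (a • y + b • T y) =
      QuadraticAlgebra.norm (⟨a, b⟩ : QuadraticAlgebra F (-d) 0) * B (T x) y := by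
  rw [cor129_pullback B T d hT hT2, norm_eq]

end Cor129

/-! ### §C (12.9): `H(x, y) := Θ_h(x, Θ′_h(y)) + √−dΘ_h(x, y) = d(x, y) + √−d(Θ′_h(x), y)` — and `=` (3.1.2) of [Mar25] -/

section Eq129

variable (B : M →ₗ[F] M →ₗ[F] F) (T : M →ₗ[F] M) (d : F)

/-- (12.9): the two printed expressions for `H(x, y)` agree in `K = F(√−d)` — real parts «`Θ_h(x, Θ′_h(y)) = d(x, y)`»,
`√−d`-coefficients «`Θ_h(x, y) = (Θ′_h(x), y)`» — and the right-hand expression «`d(x, y) + √−d(Θ′_h(x), y)`» is, symbol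
for symbol, the Hermitian form (3.1.2) `H(x, y) := d(x, y)_V + √−d(f(x), y)_V` of [Markman, arXiv:2502.03415v2] with
`f = Θ′_h`, modelled as `HermitianForm312.H` in `Markman2025/WeilHermitianFormSignature.lean`.
[cite: Markman2023GeneralizedKummers, (12.9), JEMS 25 (2023) p. 303; arXiv v4 p. 67 L65–76] -/
theorem eq129 (hT : ∀ x y, B (T x) y = -B x (T y)) (hT2 : ∀ x, T (T x) = -(d • x)) (x y : M) :
    (⟨B (T x) (T y), B (T x) y⟩ : QuadraticAlgebra F (-d) 0) = ⟨d * B x y, B (T x) y⟩ ∧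
      (⟨d * B x y, B (T x) y⟩ : QuadraticAlgebra F (-d) 0) =
        Literature.AlgebraicGeometry.Markman2025.HermitianForm312.H B T d x y := by
  refine ⟨?_, rfl⟩
  ext
  · show B (T x) (T y) = d * B x y
    rw [hT x (T y), hT2, map_neg, map_smul, smul_eq_mul, neg_neg]
  · rfl

end Eq129

end CliffordPairWeil129

end Literature.AlgebraicGeometry.HodgeTheory
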